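import Summits.CriticalPhenomena.PercolationContinuityZ3.Theorems.PercNearOneGluingNoHeavyQuantThreePortLemma12
import HarnessLib

/-!
# The three-port residual kit, III: box certificates — corner bounds and vacuous boxes

builds on p205010 (kernel theorem, internal audit signed; external expert review pending)

Support file (`--supports stmt-CriticalPhenomena-4575`), seat `prim-quant-p1` (gen 5); memo `run/shared/lean/prim/quant/P1-SURPLUS.md` §15.
No definitions, no named facts, no sorries; standard axioms.  Pure real algebra.

A HAIR BOX is `α ∈ [la,ha]`, `β ∈ [lb,hb]`, `γ ∈ [lc,hc]` (all inside `[0, ½]`).  On a box every hair-dependent coefficient of the three-port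
residual system (`ThreePort.le_one_reached_le_of_cellSolver₂`) has a monotone corner bound: `T_a⁻ = α(1−β)(1−γ) − (1−α)βγ ≤ Ta :=
T_a⁻(ha,lb,lc)` (`Tm_le_box`), `V_a = β+γ−βγ−α ≥ Va := V_a(ha,lb,lc)` (`V_ge_box`), `c_a = β+γ−2βγ ≤ c_a(hb,hc)` (`cpair_le_box`), and the
multilinear `c₃` lies between the min and max of its eight vertex values (`c3_le_of_vertices`, `c3_ge_of_vertices`).  With these
constants (`κ_v = Tv/Vv`) two chains (files `…QuantThreePortBoxDT`, `…QuantThreePortBoxGZ`) refute the residual system on a box from ONE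
numeric condition each (checked by `norm_num` per box):
* `ThreePort.dtBox_b_false` — the DT chain (Gladkov L1.2 weak row at apex `b`, `U0² ≤ (Ubc+U0)(Uab+(Uac+U0)²)`): caps give
  `Ubc ≤ κ_a U0`, `Uac ≤ κ_b U0`, `Uab ≤ κ_c U0`, hence `U0 ≤ (Ubc+U0)(κ_c + (1+κ_b)²U0)`, so `U0 ≥ U0min := (1/(1+κ_a) − κ_c)/(1+κ_b)²`
  and `Ubc ≥ U0/(κ_c+(1+κ_b)²U0) − U0`; then `Σ ≤ S + C3hi − C3lo·U0 − (C3lo − c̄_a)·Ubc ≤ S + C3hi − U0min·(C3lo + (C3lo−c̄_a)κ_a)`.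
  `dtBox_c_false`: the same at apex `c` (relabelled).
* `ThreePort.gzBox_a_false` — the GZ chain at apex `a` (the file `…QuantThreePortTwoFifths` with box constants): `Ubc ≤ ρ·I`
  (`ρ = Ta/(Ta+Va)`, `I = U0+Ubc`), `J = 1 − I ≤ Ĵ := k + (1−k)ρ` (`k = κ_b+κ_c ≤ 1`), `2 < S + Aρ + M·J` and the two endpoint conditions.
* `ThreePort.vacBox_{a,b,c}_false` (this file) — a box on which some `T_v⁻ ≤ 0` carries no residual point (that exchange holds).
This file: the corner bounds (`Tm_le_box`, `V_ge_box`, `cpair_le_box`, `affine_le_step`/`affine_ge_step`, `c3_le_of_vertices`,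
`c3_ge_of_vertices`) and the vacuous boxes.
The tiling of `[3/10, ½]³` by 177 such boxes is in `…QuantThreePortBoxTiles*`.
[cite: Gladkov2024, Lemma 1.2 (2)]; [cite: GladkovZimin2024, Thm. 4.6].
-/

noncomputable section

namespace Summit.CriticalPhenomena.PercolationContinuityZ3.Theorems

namespace ThreePort


/-! ### Monotone corner bounds on a hair box -/

/-- `T⁻(h;u,w) = h(1−u)(1−w) − (1−h)uw` is increasing in `h` and decreasing in `u, w` on `[0,1]³`. [this work] -/
theorem Tm_le_box (h u w lh hh lu hu lw hw : ℝ) (h1 : lh ≤ h) (h2 : h ≤ hh) (h3 : lu ≤ u) (h4 : u ≤ hu) (h5 : lw ≤ w)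
    (h6 : w ≤ hw) (hlh : 0 ≤ lh) (hlu : 0 ≤ lu) (hlw : 0 ≤ lw) (hhh : hh ≤ 1) (hhu : hu ≤ 1) (hhw : hw ≤ 1) :
    h * (1 - u) * (1 - w) - (1 - h) * u * w ≤ hh * (1 - lu) * (1 - lw) - (1 - hh) * lu * lw := by
  have s1 : h * (1 - u) * (1 - w) - (1 - h) * u * w ≤ hh * (1 - u) * (1 - w) - (1 - hh) * u * w := by
    have : 0 ≤ (hh - h) * ((1 - u) * (1 - w) + u * w) :=
      mul_nonneg (by linarith only [h2]) (add_nonneg (mul_nonneg (by linarith only [h4, hhu]) (by linarith only [h6, hhw]))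
        (mul_nonneg (by linarith only [h3, hlu]) (by linarith only [h5, hlw])))
    linarith only [this]
  have s2 : hh * (1 - u) * (1 - w) - (1 - hh) * u * w ≤ hh * (1 - lu) * (1 - w) - (1 - hh) * lu * w := by
    have : 0 ≤ (u - lu) * (hh * (1 - w) + (1 - hh) * w) :=
      mul_nonneg (by linarith only [h3]) (add_nonneg (mul_nonneg (by linarith only [h1, h2, hlh]) (by linarith only [h6, hhw]))
        (mul_nonneg (by linarith only [hhh]) (by linarith only [h5, hlw])))
    linarith only [this]
  have s3 : hh * (1 - lu) * (1 - w) - (1 - hh) * lu * w ≤ hh * (1 - lu) * (1 - lw) - (1 - hh) * lu * lw := by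
    have : 0 ≤ (w - lw) * (hh * (1 - lu) + (1 - hh) * lu) :=
      mul_nonneg (by linarith only [h5]) (add_nonneg (mul_nonneg (by linarith only [h1, h2, hlh]) (by linarith only [h3, h4, hhu]))
        (mul_nonneg (by linarith only [hhh]) hlu))
    linarith only [this]
  linarith only [s1, s2, s3]

/-- `V(h;u,w) = u+w−uw−h` is decreasing in `h` and increasing in `u, w` (for `u, w ≤ 1`). [this work] -/
theorem V_ge_box (h u w hh lu lw : ℝ) (h2 : h ≤ hh) (h3 : lu ≤ u) (h5 : lw ≤ w) (hw1 : w ≤ 1) (hlu1 : lu ≤ 1) :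
    lu + lw - lu * lw - hh ≤ u + w - u * w - h := by
  have e : (u + w - u * w) - (lu + lw - lu * lw) = (u - lu) * (1 - w) + (w - lw) * (1 - lu) := by ring
  have : 0 ≤ (u - lu) * (1 - w) + (w - lw) * (1 - lu) :=
    add_nonneg (mul_nonneg (by linarith only [h3]) (by linarith only [hw1])) (mul_nonneg (by linarith only [h5]) (by linarith only [hlu1]))
  linarith only [e, this, h2]

/-- The pair coefficient `u+w−2uw` is increasing in each variable on `[0, ½]²`. [this work] -/
theorem cpair_le_box (u w hu hw : ℝ) (h4 : u ≤ hu) (h6 : w ≤ hw) (hhu : hu ≤ 1 / 2) (hw0 : w ≤ 1 / 2) :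
    u + w - 2 * u * w ≤ hu + hw - 2 * hu * hw := by
  have e : (hu + hw - 2 * hu * hw) - (u + w - 2 * u * w) = (hu - u) * (1 - 2 * w) + (hw - w) * (1 - 2 * hu) := by ring
  have : 0 ≤ (hu - u) * (1 - 2 * w) + (hw - w) * (1 - 2 * hu) :=
    add_nonneg (mul_nonneg (by linarith only [h4]) (by linarith only [hw0])) (mul_nonneg (by linarith only [h6]) (by linarith only [hhu]))
  linarith only [e, this]

/-- One step of multilinear interpolation: an affine function on `[lo, hi]` is below `M` if it is at both ends. [folklore] -/
theorem affine_le_step (fx flo fhi B x lo hi M : ℝ) (hlo : lo ≤ x) (hhi : x ≤ hi) (e1 : fx - flo = (x - lo) * B)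
    (e2 : fhi - fx = (hi - x) * B) (h1 : flo ≤ M) (h2 : fhi ≤ M) : fx ≤ M := by
  rcases le_or_gt 0 B with hB | hB
  · have : 0 ≤ (hi - x) * B := mul_nonneg (by linarith only [hhi]) hB
    linarith only [e2, this, h2]
  · have : (x - lo) * B ≤ 0 := mul_nonpos_of_nonneg_of_nonpos (by linarith only [hlo]) hB.le
    linarith only [e1, this, h1]

/-- One step of multilinear interpolation, lower bound. [folklore] -/
theorem affine_ge_step (fx flo fhi B x lo hi M : ℝ) (hlo : lo ≤ x) (hhi : x ≤ hi) (e1 : fx - flo = (x - lo) * B)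
    (e2 : fhi - fx = (hi - x) * B) (h1 : M ≤ flo) (h2 : M ≤ fhi) : M ≤ fx := by
  rcases le_or_gt 0 B with hB | hB
  · have : 0 ≤ (x - lo) * B := mul_nonneg (by linarith only [hlo]) hB
    linarith only [e1, this, h1]
  · have : (hi - x) * B ≤ 0 := mul_nonpos_of_nonneg_of_nonpos (by linarith only [hhi]) hB.le
    linarith only [e2, this, h2]

/-- `c₃` is multilinear: on a box it is at most the largest of its eight vertex values. [this work] -/
theorem c3_le_of_vertices (α β γ la ha lb hb lc hc M : ℝ) (h1 : la ≤ α) (h2 : α ≤ ha) (h3 : lb ≤ β) (h4 : β ≤ hb)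
    (h5 : lc ≤ γ) (h6 : γ ≤ hc)
    (v1 : (1 - la) * (lb + lc - lb * lc) + (1 - lb) * (la + lc - la * lc) + (1 - lc) * (la + lb - la * lb) ≤ M)
    (v2 : (1 - la) * (lb + hc - lb * hc) + (1 - lb) * (la + hc - la * hc) + (1 - hc) * (la + lb - la * lb) ≤ M)
    (v3 : (1 - la) * (hb + lc - hb * lc) + (1 - hb) * (la + lc - la * lc) + (1 - lc) * (la + hb - la * hb) ≤ M)
    (v4 : (1 - la) * (hb + hc - hb * hc) + (1 - hb) * (la + hc - la * hc) + (1 - hc) * (la + hb - la * hb) ≤ M)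
    (v5 : (1 - ha) * (lb + lc - lb * lc) + (1 - lb) * (ha + lc - ha * lc) + (1 - lc) * (ha + lb - ha * lb) ≤ M)
    (v6 : (1 - ha) * (lb + hc - lb * hc) + (1 - lb) * (ha + hc - ha * hc) + (1 - hc) * (ha + lb - ha * lb) ≤ M)
    (v7 : (1 - ha) * (hb + lc - hb * lc) + (1 - hb) * (ha + lc - ha * lc) + (1 - lc) * (ha + hb - ha * hb) ≤ M)
    (v8 : (1 - ha) * (hb + hc - hb * hc) + (1 - hb) * (ha + hc - ha * hc) + (1 - hc) * (ha + hb - ha * hb) ≤ M) :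
    (1 - α) * (β + γ - β * γ) + (1 - β) * (α + γ - α * γ) + (1 - γ) * (α + β - α * β) ≤ M := by
  -- γ-steps at the four (α,β)-vertices, then β-steps at the two α-vertices, then the α-step
  have g1 : (1 - la) * (lb + γ - lb * γ) + (1 - lb) * (la + γ - la * γ) + (1 - γ) * (la + lb - la * lb) ≤ M :=
    affine_le_step _ _ _ (2 * (1 - la) * (1 - lb) - (la + lb - la * lb)) γ lc hc M h5 h6 (by ring) (by ring) v1 v2
  have g2 : (1 - la) * (hb + γ - hb * γ) + (1 - hb) * (la + γ - la * γ) + (1 - γ) * (la + hb - la * hb) ≤ M :=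
    affine_le_step _ _ _ (2 * (1 - la) * (1 - hb) - (la + hb - la * hb)) γ lc hc M h5 h6 (by ring) (by ring) v3 v4
  have g3 : (1 - ha) * (lb + γ - lb * γ) + (1 - lb) * (ha + γ - ha * γ) + (1 - γ) * (ha + lb - ha * lb) ≤ M :=
    affine_le_step _ _ _ (2 * (1 - ha) * (1 - lb) - (ha + lb - ha * lb)) γ lc hc M h5 h6 (by ring) (by ring) v5 v6
  have g4 : (1 - ha) * (hb + γ - hb * γ) + (1 - hb) * (ha + γ - ha * γ) + (1 - γ) * (ha + hb - ha * hb) ≤ M :=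
    affine_le_step _ _ _ (2 * (1 - ha) * (1 - hb) - (ha + hb - ha * hb)) γ lc hc M h5 h6 (by ring) (by ring) v7 v8
  have b1 : (1 - la) * (β + γ - β * γ) + (1 - β) * (la + γ - la * γ) + (1 - γ) * (la + β - la * β) ≤ M :=
    affine_le_step _ _ _ (2 * (1 - la) * (1 - γ) - (la + γ - la * γ)) β lb hb M h3 h4 (by ring) (by ring) g1 g2
  have b2 : (1 - ha) * (β + γ - β * γ) + (1 - β) * (ha + γ - ha * γ) + (1 - γ) * (ha + β - ha * β) ≤ M :=
    affine_le_step _ _ _ (2 * (1 - ha) * (1 - γ) - (ha + γ - ha * γ)) β lb hb M h3 h4 (by ring) (by ring) g3 g4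
  exact affine_le_step _ _ _ (2 * (1 - β) * (1 - γ) - (β + γ - β * γ)) α la ha M h1 h2 (by ring) (by ring) b1 b2

/-- `c₃` is multilinear: on a box it is at least the smallest of its eight vertex values. [this work] -/
theorem c3_ge_of_vertices (α β γ la ha lb hb lc hc M : ℝ) (h1 : la ≤ α) (h2 : α ≤ ha) (h3 : lb ≤ β) (h4 : β ≤ hb)
    (h5 : lc ≤ γ) (h6 : γ ≤ hc)
    (v1 : M ≤ (1 - la) * (lb + lc - lb * lc) + (1 - lb) * (la + lc - la * lc) + (1 - lc) * (la + lb - la * lb))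
    (v2 : M ≤ (1 - la) * (lb + hc - lb * hc) + (1 - lb) * (la + hc - la * hc) + (1 - hc) * (la + lb - la * lb))
    (v3 : M ≤ (1 - la) * (hb + lc - hb * lc) + (1 - hb) * (la + lc - la * lc) + (1 - lc) * (la + hb - la * hb))
    (v4 : M ≤ (1 - la) * (hb + hc - hb * hc) + (1 - hb) * (la + hc - la * hc) + (1 - hc) * (la + hb - la * hb))
    (v5 : M ≤ (1 - ha) * (lb + lc - lb * lc) + (1 - lb) * (ha + lc - ha * lc) + (1 - lc) * (ha + lb - ha * lb))
    (v6 : M ≤ (1 - ha) * (lb + hc - lb * hc) + (1 - lb) * (ha + hc - ha * hc) + (1 - hc) * (ha + lb - ha * lb))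
    (v7 : M ≤ (1 - ha) * (hb + lc - hb * lc) + (1 - hb) * (ha + lc - ha * lc) + (1 - lc) * (ha + hb - ha * hb))
    (v8 : M ≤ (1 - ha) * (hb + hc - hb * hc) + (1 - hb) * (ha + hc - ha * hc) + (1 - hc) * (ha + hb - ha * hb)) :
    M ≤ (1 - α) * (β + γ - β * γ) + (1 - β) * (α + γ - α * γ) + (1 - γ) * (α + β - α * β) := by
  have g1 : M ≤ (1 - la) * (lb + γ - lb * γ) + (1 - lb) * (la + γ - la * γ) + (1 - γ) * (la + lb - la * lb) :=
    affine_ge_step _ _ _ (2 * (1 - la) * (1 - lb) - (la + lb - la * lb)) γ lc hc M h5 h6 (by ring) (by ring) v1 v2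
  have g2 : M ≤ (1 - la) * (hb + γ - hb * γ) + (1 - hb) * (la + γ - la * γ) + (1 - γ) * (la + hb - la * hb) :=
    affine_ge_step _ _ _ (2 * (1 - la) * (1 - hb) - (la + hb - la * hb)) γ lc hc M h5 h6 (by ring) (by ring) v3 v4
  have g3 : M ≤ (1 - ha) * (lb + γ - lb * γ) + (1 - lb) * (ha + γ - ha * γ) + (1 - γ) * (ha + lb - ha * lb) :=
    affine_ge_step _ _ _ (2 * (1 - ha) * (1 - lb) - (ha + lb - ha * lb)) γ lc hc M h5 h6 (by ring) (by ring) v5 v6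
  have g4 : M ≤ (1 - ha) * (hb + γ - hb * γ) + (1 - hb) * (ha + γ - ha * γ) + (1 - γ) * (ha + hb - ha * hb) :=
    affine_ge_step _ _ _ (2 * (1 - ha) * (1 - hb) - (ha + hb - ha * hb)) γ lc hc M h5 h6 (by ring) (by ring) v7 v8
  have b1 : M ≤ (1 - la) * (β + γ - β * γ) + (1 - β) * (la + γ - la * γ) + (1 - γ) * (la + β - la * β) :=
    affine_ge_step _ _ _ (2 * (1 - la) * (1 - γ) - (la + γ - la * γ)) β lb hb M h3 h4 (by ring) (by ring) g1 g2
  have b2 : M ≤ (1 - ha) * (β + γ - β * γ) + (1 - β) * (ha + γ - ha * γ) + (1 - γ) * (ha + β - ha * β) :=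
    affine_ge_step _ _ _ (2 * (1 - ha) * (1 - γ) - (ha + γ - ha * γ)) β lb hb M h3 h4 (by ring) (by ring) g3 g4
  exact affine_ge_step _ _ _ (2 * (1 - β) * (1 - γ) - (β + γ - β * γ)) α la ha M h1 h2 (by ring) (by ring) b1 b2

/-! ### Vacuous boxes: some `T_v⁻ ≤ 0` on the whole box (that exchange holds) -/

/-- If `T_a⁻ ≤ 0` on the box then the exchange at `a` cannot fail. [this work] -/
theorem vacBox_a_false (α β γ U0 Ubc la ha lb hb lc hc : ℝ)
    (a1 : la ≤ α) (a2 : α ≤ ha) (b1 : lb ≤ β) (b2 : β ≤ hb) (c1 : lc ≤ γ) (c2 : γ ≤ hc) (h0 : 0 ≤ U0) (hbc : 0 ≤ Ubc)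
    (ga : U0 * ((1 - α) * β * γ - α * (1 - β) * (1 - γ)) + Ubc * (β + γ - β * γ - α) < 0)
    (hnum : 0 ≤ la ∧ 0 ≤ lb ∧ 0 ≤ lc ∧ ha ≤ 1 / 2 ∧ hb ≤ 1 / 2 ∧ hc ≤ 1 / 2 ∧
      (ha * (1 - lb) * (1 - lc) - (1 - ha) * lb * lc) ≤ 0 ∧ 0 ≤ (lb + lc - lb * lc - ha)) : False := by
  obtain ⟨hla, hlb, hlc, hha, hhb, hhc, hT, hV⟩ := hnum
  have hT_a : α * (1 - β) * (1 - γ) - (1 - α) * β * γ ≤ ha * (1 - lb) * (1 - lc) - (1 - ha) * lb * lc :=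
    Tm_le_box α β γ la ha lb hb lc hc a1 a2 b1 b2 c1 c2 hla hlb hlc (by linarith only [hha]) (by linarith only [hhb])
      (by linarith only [hhc])
  have hV_a : lb + lc - lb * lc - ha ≤ β + γ - β * γ - α :=
    V_ge_box α β γ ha lb lc a2 b1 c1 (by linarith only [c2, hhc]) (by linarith only [b1, b2, hhb])
  have h1 : U0 * (α * (1 - β) * (1 - γ) - (1 - α) * β * γ) ≤ 0 :=
    mul_nonpos_of_nonneg_of_nonpos h0 (by linarith only [hT_a, hT])
  have h2 : 0 ≤ Ubc * (β + γ - β * γ - α) := mul_nonneg hbc (by linarith only [hV_a, hV])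
  linarith only [ga, h1, h2]

/-- If `T_b⁻ ≤ 0` on the box then the exchange at `b` cannot fail. [this work] -/
theorem vacBox_b_false (α β γ U0 Uac la ha lb hb lc hc : ℝ)
    (a1 : la ≤ α) (a2 : α ≤ ha) (b1 : lb ≤ β) (b2 : β ≤ hb) (c1 : lc ≤ γ) (c2 : γ ≤ hc) (h0 : 0 ≤ U0) (hac : 0 ≤ Uac)
    (gb : U0 * ((1 - β) * α * γ - β * (1 - α) * (1 - γ)) + Uac * (α + γ - α * γ - β) < 0)
    (hnum : 0 ≤ la ∧ 0 ≤ lb ∧ 0 ≤ lc ∧ ha ≤ 1 / 2 ∧ hb ≤ 1 / 2 ∧ hc ≤ 1 / 2 ∧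
      (hb * (1 - la) * (1 - lc) - (1 - hb) * la * lc) ≤ 0 ∧ 0 ≤ (la + lc - la * lc - hb)) : False := by
  obtain ⟨hla, hlb, hlc, hha, hhb, hhc, hT, hV⟩ := hnum
  exact vacBox_a_false β α γ U0 Uac lb hb la ha lc hc b1 b2 a1 a2 c1 c2 h0 hac (by linarith only [gb])
    ⟨hlb, hla, hlc, hhb, hha, hhc, hT, hV⟩

/-- If `T_c⁻ ≤ 0` on the box then the exchange at `c` cannot fail. [this work] -/
theorem vacBox_c_false (α β γ U0 Uab la ha lb hb lc hc : ℝ)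
    (a1 : la ≤ α) (a2 : α ≤ ha) (b1 : lb ≤ β) (b2 : β ≤ hb) (c1 : lc ≤ γ) (c2 : γ ≤ hc) (h0 : 0 ≤ U0) (hab : 0 ≤ Uab)
    (gc : U0 * ((1 - γ) * α * β - γ * (1 - α) * (1 - β)) + Uab * (α + β - α * β - γ) < 0)
    (hnum : 0 ≤ la ∧ 0 ≤ lb ∧ 0 ≤ lc ∧ ha ≤ 1 / 2 ∧ hb ≤ 1 / 2 ∧ hc ≤ 1 / 2 ∧
      (hc * (1 - la) * (1 - lb) - (1 - hc) * la * lb) ≤ 0 ∧ 0 ≤ (la + lb - la * lb - hc)) : False := by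
  obtain ⟨hla, hlb, hlc, hha, hhb, hhc, hT, hV⟩ := hnum
  exact vacBox_a_false γ α β U0 Uab lc hc la ha lb hb c1 c2 a1 a2 b1 b2 h0 hab (by linarith only [gc])
    ⟨hlc, hla, hlb, hhc, hha, hhb, hT, hV⟩

end ThreePort

end Summit.CriticalPhenomena.PercolationContinuityZ3.Theorems

end
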